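import Summits.KontsevichZagierPeriods.KontsevichZagierPeriods.Theses.HurwitzMicroSectors
import Summits.KontsevichZagierPeriods.KontsevichZagierPeriods.Theorems.HurwitzMicroSectorsNormalFormPrinciplePiBoxTransfer
import Summits.KontsevichZagierPeriods.KontsevichZagierPeriods.Theorems.HurwitzMicroSectorsNormalFormPrincipleVariants2239
import Summits.KontsevichZagierPeriods.KontsevichZagierPeriods.Theorems.HurwitzMicroSectorsNormalFormPrincipleVariants2320

/-! TTRL-lite variant V2323 of stmt-KontsevichZagierPeriods-3869

Variant V2323 = `stub_boxRigidity` (BoxRigidity: two box-rational representations — domain the open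
unit box, integrand `p/q` over `ℚ` — with equal values are KZ-equivalent) under the move
`fix_nat:m=8; bound_nat:m'≤3` (left dimension frozen to `8`, right dimension `m' ≤ 3`). Verdict of the
attempt seat: **open** — this file is the exact-strength certificate, not a proof of the variant.
By the general fact `boxRigidityFixBound_iff_boxVanishing` (file `…Variants2320`: freeze one dimension
to `K`, bound the other by `b ≤ K` — the result is BoxVanishing in dimension `K`; forward by comparison
with the zero representation on the `0`-box, backward by padding to `(0,1)ᴷ` and subtracting,
`boxRigidityLe_of_boxVanishing` of `…Variants2239`) the variant is **BoxVanishing(`8`)**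
(`stub_boxRigidity_var2323_iff_boxVanishing_eight`): every rational integrand on `(0,1)⁸` with
integral `0` is a KZ relation — Conjecture 1 of Kontsevich–Zagier for all box-rational periods of
dimension `≤ 8` (`stub_boxRigidity_var2323_iff_le_eight`), among them `π⁸`, `ζ(3)`, `ζ(5)`, `ζ(7)`,
`ζ(3)ζ(5)`, `ζ(3,5)`, Catalan's `G`. Hence V2323 is the SAME statement as the sibling V2320
(`m' ≤ 2`; `stub_boxRigidity_var2323_iff_var2320`): the bound on `m'` is idle as soon as `m' = 0` is
allowed. It implies BoxVanishing in every dimension `≤ 8`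
(`boxVanishing_le_eight_of_stub_boxRigidity_var2323`), in particular the open dimension-`3` rung
(V2239: `ζ(3) ∉ ℚ + ℚπ²`, irrationality of `G`). Upward `KontsevichZagierPeriods ⇒ parent ⇒ V2323`
(`stub_boxRigidity_var2323_of_statement`), so a refutation would refute the Summit, and the tree has no
invariant of `KZ.relations` finer than `eval`. The proved two-sided instance is `m, m' ≤ 1` (Baker).
Source: M. Kontsevich, D. Zagier, *Periods* (2001), §1.2 Conjecture 1. Pure proof file, no definitions. -/

-- `Summit.<Summit>.<Problem>` is the tree's mandated summit-side namespace (CONVENTIONS §2); for this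
-- single-conjunct summit the two coincide, so the duplicate is deliberate.
set_option linter.dupNamespace false

noncomputable section

namespace Summit.KontsevichZagierPeriods.KontsevichZagierPeriods.Theorems

open MeasureTheory Set
open Literature.NumberTheory.Transcendental Literature.NumberTheory.Transcendental.KZ
open Summit.KontsevichZagierPeriods.KontsevichZagierPeriods.Theses.HurwitzMicroSectors
open Summit.KontsevichZagierPeriods.HurwitzMicroSectors.NormalFormPrinciple.PiBox

/-! ## The variant V2323: Conjecture 1 for box-rational periods of dimension 8 -/

/-- **V2323 ⟺ BoxVanishing in dimension `8`** (every box-rational representation on `(0,1)⁸` of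
value `0` is a KZ relation; instance `K = 8`, `b = 3` of `boxRigidityFixBound_iff_boxVanishing`).
[cite: KontsevichZagier2001, §1.2 Conjecture 1] -/
theorem stub_boxRigidity_var2323_iff_boxVanishing_eight :
    (∀ (m' : ℕ) (N : IntegralRep 8) (N' : IntegralRep m'), m' ≤ 3 → N.domain = {x | ∀ i, x i ∈ Set.Ioo (0:ℝ) 1} → N.IsRational → N'.domain = {x | ∀ i, x i ∈ Set.Ioo (0:ℝ) 1} → N'.IsRational → N.value = N'.value → Equivalent N N') ↔
    (∀ (N : IntegralRep 8), N.domain = {x | ∀ i, x i ∈ Set.Ioo (0:ℝ) 1} → N.IsRational →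
      N.value = 0 → of N ∈ relations) :=
  boxRigidityFixBound_iff_boxVanishing (by norm_num)

/-- **V2323 ⟺ BoxRigidity under the joint bound `m, m' ≤ 8`** (the honest strength of the variant:
Conjecture 1 for all pairs of rational integrands on the open unit boxes of dimension at most `8`;
freezing `m := 8` and cutting `m'` down to `3` loses nothing). [cite: KontsevichZagier2001, §1.2 Conjecture 1] -/
theorem stub_boxRigidity_var2323_iff_le_eight :
    (∀ (m' : ℕ) (N : IntegralRep 8) (N' : IntegralRep m'), m' ≤ 3 → N.domain = {x | ∀ i, x i ∈ Set.Ioo (0:ℝ) 1} → N.IsRational → N'.domain = {x | ∀ i, x i ∈ Set.Ioo (0:ℝ) 1} → N'.IsRational → N.value = N'.value → Equivalent N N') ↔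
    (∀ (m m' : ℕ) (N : IntegralRep m) (N' : IntegralRep m'), m' ≤ 8 → m ≤ 8 →
      N.domain = {x | ∀ i, x i ∈ Set.Ioo (0:ℝ) 1} → N.IsRational →
      N'.domain = {x | ∀ i, x i ∈ Set.Ioo (0:ℝ) 1} → N'.IsRational →
      N.value = N'.value → Equivalent N N') :=
  ⟨fun h => boxRigidityLe_of_boxVanishing (j := 8) (k := 8) le_rfl le_rfl
      (stub_boxRigidity_var2323_iff_boxVanishing_eight.1 h),
    fun h m' N N' hm' => h 8 m' N N' (hm'.trans (by norm_num)) le_rfl⟩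

/-- **V2323 ⟺ the sibling V2320** (`fix_nat:m=8; bound_nat:m'≤2`): both are BoxVanishing(`8`), the
bound on `m'` is idle. [cite: KontsevichZagier2001, §1.2 Conjecture 1] -/
theorem stub_boxRigidity_var2323_iff_var2320 :
    (∀ (m' : ℕ) (N : IntegralRep 8) (N' : IntegralRep m'), m' ≤ 3 → N.domain = {x | ∀ i, x i ∈ Set.Ioo (0:ℝ) 1} → N.IsRational → N'.domain = {x | ∀ i, x i ∈ Set.Ioo (0:ℝ) 1} → N'.IsRational → N.value = N'.value → Equivalent N N') ↔
    (∀ (m' : ℕ) (N : IntegralRep 8) (N' : IntegralRep m'), m' ≤ 2 → N.domain = {x | ∀ i, x i ∈ Set.Ioo (0:ℝ) 1} → N.IsRational → N'.domain = {x | ∀ i, x i ∈ Set.Ioo (0:ℝ) 1} → N'.IsRational → N.value = N'.value → Equivalent N N') := by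
  rw [stub_boxRigidity_var2323_iff_boxVanishing_eight, stub_boxRigidity_var2320_iff_boxVanishing_eight]

/-- **V2323 ⇒ BoxVanishing in every dimension `≤ 8`** (monotonicity along padding), in particular the
open dimension-`3` and dimension-`2` rungs. [cite: KontsevichZagier2001, §1.2 Conjecture 1] -/
theorem boxVanishing_le_eight_of_stub_boxRigidity_var2323
    (h : ∀ (m' : ℕ) (N : IntegralRep 8) (N' : IntegralRep m'), m' ≤ 3 → N.domain = {x | ∀ i, x i ∈ Set.Ioo (0:ℝ) 1} → N.IsRational → N'.domain = {x | ∀ i, x i ∈ Set.Ioo (0:ℝ) 1} → N'.IsRational → N.value = N'.value → Equivalent N N')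
    {m : ℕ} (hm : m ≤ 8) (N : IntegralRep m) (hNd : N.domain = {x | ∀ i, x i ∈ Set.Ioo (0:ℝ) 1})
    (hNr : N.IsRational) (hv : N.value = 0) : of N ∈ relations :=
  boxVanishing_mono hm (stub_boxRigidity_var2323_iff_boxVanishing_eight.1 h) N hNd hNr hv

/-- **V2323 ⇒ the sibling V2239** (`bound_nat:m≤3; bound_nat:m'≤2` = BoxVanishing(`3`), open: it
contains `[1/(1−xyz)]` versus `[a + b/(1−xy)]`, i.e. the case split `ζ(3) ∈ ℚ + ℚπ²`, and the
level-`4` weight-`2` sector without `Indep_ℚ(1, π², G)`). [cite: KontsevichZagier2001, §1.2 Conjecture 1] -/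
theorem stub_boxRigidity_var2239_of_var2323
    (h : ∀ (m' : ℕ) (N : IntegralRep 8) (N' : IntegralRep m'), m' ≤ 3 → N.domain = {x | ∀ i, x i ∈ Set.Ioo (0:ℝ) 1} → N.IsRational → N'.domain = {x | ∀ i, x i ∈ Set.Ioo (0:ℝ) 1} → N'.IsRational → N.value = N'.value → Equivalent N N') :
    ∀ (m m' : ℕ) (N : IntegralRep m) (N' : IntegralRep m'), m' ≤ 2 → m ≤ 3 → N.domain = {x | ∀ i, x i ∈ Set.Ioo (0:ℝ) 1} → N.IsRational → N'.domain = {x | ∀ i, x i ∈ Set.Ioo (0:ℝ) 1} → N'.IsRational → N.value = N'.value → Equivalent N N' :=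
  stub_boxRigidity_var2239_iff_boxVanishing_three.2
    (fun N hNd hNr hv => boxVanishing_le_eight_of_stub_boxRigidity_var2323 h (by norm_num) N hNd hNr hv)

/-- **parent ⇒ V2323** (the variant is a specialisation of `stub_boxRigidity`).
[cite: KontsevichZagier2001, §1.2 Conjecture 1] -/
theorem stub_boxRigidity_var2323_of_parent
    (h : ∀ (m m' : ℕ) (N : IntegralRep m) (N' : IntegralRep m'), N.domain = {x | ∀ i, x i ∈ Set.Ioo (0:ℝ) 1} → N.IsRational → N'.domain = {x | ∀ i, x i ∈ Set.Ioo (0:ℝ) 1} → N'.IsRational → N.value = N'.value → Equivalent N N') :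
    ∀ (m' : ℕ) (N : IntegralRep 8) (N' : IntegralRep m'), m' ≤ 3 → N.domain = {x | ∀ i, x i ∈ Set.Ioo (0:ℝ) 1} → N.IsRational → N'.domain = {x | ∀ i, x i ∈ Set.Ioo (0:ℝ) 1} → N'.IsRational → N.value = N'.value → Equivalent N N' :=
  fun m' N N' _ => h 8 m' N N'

/-- **`KontsevichZagierPeriods ⇒ V2323`**: the variant is a special case of Conjecture 1 for the
tree's calculus — a refutation of the variant would refute the Summit.
[cite: KontsevichZagier2001, §1.2 Conjecture 1] -/
theorem stub_boxRigidity_var2323_of_statement (h : _root_.KontsevichZagierPeriods) :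
    ∀ (m' : ℕ) (N : IntegralRep 8) (N' : IntegralRep m'), m' ≤ 3 → N.domain = {x | ∀ i, x i ∈ Set.Ioo (0:ℝ) 1} → N.IsRational → N'.domain = {x | ∀ i, x i ∈ Set.Ioo (0:ℝ) 1} → N'.IsRational → N.value = N'.value → Equivalent N N' :=
  stub_boxRigidity_var2323_of_parent (leaves_of_statement h).1

end Summit.KontsevichZagierPeriods.KontsevichZagierPeriods.Theorems
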